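import Summits.ResolutionOfSingularities.KangarooAtlas.MizutaniTowerDerivation
import Summits.ResolutionOfSingularities.KangarooAtlas.MizutaniLemma29
import HarnessLib

/-!
# The six second-order operators of a two-generator tower and the count `#ι ≤ 2p` (Mizutani 1973, Thm. 2.8 Step (II) via Lemma 2.9 (1))

Cell `pub-rosobs`, Mizutani enclosure (seat mizutani-encloser-2, gen 7). AI-written; AI review is weaker than expert
review; NOT a resolution-of-singularities theorem (summit relevance C).

Mizutani (Nagoya Math. J. 52 (1973) p. 91–92): «`dim_K Diff_2(K/k^p) = 6`, thus there exists `D` in `Diff_2(K/k^p)` such that `D ≠ 0` and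
`D(f) = 0` … by Lemma 2.9 below `dim c(f*) ≤ 2p`».  For a root tower `h : IsRootTower L K p x a` with TWO generators this file provides:

* `IsRootTower.dlin` (the derivations `∂_0, ∂_1` as linear maps), **`IsRootTower.sixOps`** (`1, ∂_0, ∂_1, ∂_0², ∂_0∂_1, ∂_1²`),
  `sum_smul_sixOps_apply`, `isDiffOpLE_sixOps` (order `≤ 2`);
* **`IsRootTower.eq_zero_of_sum_smul_sixOps_eq_zero`** — for `p ≠ 2` the six operators are `K`-linearly independent (evaluate at
  `1, a_0, a_1, a_0², a_0a_1, a_1²`);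
* **`IsRootTower.card_le_two_mul_of_sixOps`** — if `L`-independent `v_i ∈ K` (among them `1, a_0, a_1`) satisfy a nontrivial relation
  `Σ_t ν_t op_t(v_i) = 0`, then `#ι ≤ 2p`: the operator `Σ ν_t op_t ≠ 0` has order `≤ 2`, kills `1, a_0, a_1` and the `v_i`, and encloser-1's
  `IsRootTower.finrank_ker_le_two_mul` (MIZUTANI'S LEMMA 2.9 (1), `MizutaniLemma29.lean`) bounds its kernel.

Used by `MizutaniExtremalOdd.lean` (Thm. 2.8 second part, Step (II), all `p`).

## References

* H. Mizutani, *Hironaka's additive group schemes*, Nagoya Math. J. 52 (1973) 85–95, proof of Thm. 2.8, Steps (I)–(II), Lemma 2.9 (1).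
  [Mizutani1973HironakaGroupSchemes]
-/

noncomputable section

open MvPolynomial Literature.AlgebraicGeometry.Resolution

namespace Summit.ResolutionOfSingularities.KangarooAtlas.Mizutani

universe u

/-! ## The six operators `1, ∂_0, ∂_1, ∂_0², ∂_0∂_1, ∂_1²` of a two-generator tower -/

section SixOps

variable {L K : Type u} [Field L] [Field K] [Algebra L K] {p : ℕ} [hp : Fact p.Prime] [CharP K p]
  {x : Fin 2 → L} {a : Fin 2 → K}

/-- The derivation `∂_j` of the two-generator tower as a linear map. [folklore] -/
def IsRootTower.dlin (h : IsRootTower L K (p ^ 1) x a) (j : Fin 2) : K →ₗ[L] K :=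
  ((h.der le_rfl j : Derivation L K K) : K →ₗ[L] K)

/-- `∂_j` unfolded. [folklore] -/
theorem IsRootTower.dlin_apply (h : IsRootTower L K (p ^ 1) x a) (j : Fin 2) (z : K) : h.dlin j z = h.der le_rfl j z := rfl

/-- **The six operators `1, ∂_0, ∂_1, ∂_0², ∂_0∂_1, ∂_1²`** (a `K`-basis of `Diff_2(K/L)` when `p ≠ 2`; Mizutani: «dim_K Diff_2(K/k^p) = 6»).
[cite: Mizutani1973HironakaGroupSchemes, proof of Thm. 2.8, Step (I) (p. 91)] -/
def IsRootTower.sixOps (h : IsRootTower L K (p ^ 1) x a) : Fin 6 → (K →ₗ[L] K) :=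
  ![LinearMap.id, h.dlin 0, h.dlin 1, h.dlin 0 ∘ₗ h.dlin 0, h.dlin 0 ∘ₗ h.dlin 1, h.dlin 1 ∘ₗ h.dlin 1]

/-- A combination of the six operators, evaluated. [folklore] -/
theorem IsRootTower.sum_smul_sixOps_apply (h : IsRootTower L K (p ^ 1) x a) (ν : Fin 6 → K) (z : K) :
    (∑ t, ν t • h.sixOps t) z = ν 0 * z + ν 1 * h.dlin 0 z + ν 2 * h.dlin 1 z + ν 3 * h.dlin 0 (h.dlin 0 z) +
      ν 4 * h.dlin 0 (h.dlin 1 z) + ν 5 * h.dlin 1 (h.dlin 1 z) := by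
  rw [LinearMap.sum_apply, Fin.sum_univ_six]
  rfl

/-- The six operators have order `≤ 2`. [cite: EGAIV4, Prop. 16.8.9 (orders add under composition)] -/
theorem IsRootTower.isDiffOpLE_sixOps (h : IsRootTower L K (p ^ 1) x a) (t : Fin 6) : IsDiffOpLE L 2 (h.sixOps t) := by
  have h1 : ∀ j, IsDiffOpLE L 1 (h.dlin j) := fun j => (h.der le_rfl j).isDiffOpLE_one
  have e0 : h.sixOps 0 = LinearMap.id := rfl
  have e1 : h.sixOps 1 = h.dlin 0 := rfl
  have e2 : h.sixOps 2 = h.dlin 1 := rfl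
  have e3 : h.sixOps 3 = h.dlin 0 ∘ₗ h.dlin 0 := rfl
  have e4 : h.sixOps 4 = h.dlin 0 ∘ₗ h.dlin 1 := rfl
  have e5 : h.sixOps 5 = h.dlin 1 ∘ₗ h.dlin 1 := rfl
  fin_cases t
  · rw [show ((⟨0, by norm_num⟩ : Fin 6)) = 0 from rfl, e0]; exact (isDiffOpLE_id (R := L)).of_le (by norm_num)
  · rw [show ((⟨1, by norm_num⟩ : Fin 6)) = 1 from rfl, e1]; exact (h1 0).of_le (by norm_num)
  · rw [show ((⟨2, by norm_num⟩ : Fin 6)) = 2 from rfl, e2]; exact (h1 1).of_le (by norm_num)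
  · rw [show ((⟨3, by norm_num⟩ : Fin 6)) = 3 from rfl, e3]; exact (h1 0).comp (h1 0)
  · rw [show ((⟨4, by norm_num⟩ : Fin 6)) = 4 from rfl, e4]; exact (h1 0).comp (h1 1)
  · rw [show ((⟨5, by norm_num⟩ : Fin 6)) = 5 from rfl, e5]; exact (h1 1).comp (h1 1)

/-- **The six operators are `K`-linearly independent for `p ≠ 2`** (evaluate a vanishing combination at `1, a_0, a_1, a_0², a_0a_1, a_1²`).
[cite: Mizutani1973HironakaGroupSchemes, proof of Thm. 2.8, Step (I) («dim_K Diff_2(K/k^p) = 6»)] -/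
theorem IsRootTower.eq_zero_of_sum_smul_sixOps_eq_zero (h : IsRootTower L K (p ^ 1) x a) (hp2 : p ≠ 2) {ν : Fin 6 → K}
    (hν : ∑ t, ν t • h.sixOps t = 0) : ν = 0 := by
  have hz : ∀ z, ν 0 * z + ν 1 * h.dlin 0 z + ν 2 * h.dlin 1 z + ν 3 * h.dlin 0 (h.dlin 0 z) +
      ν 4 * h.dlin 0 (h.dlin 1 z) + ν 5 * h.dlin 1 (h.dlin 1 z) = 0 := fun z => by
    rw [← h.sum_smul_sixOps_apply, hν, LinearMap.zero_apply]
  have hgen : ∀ j j' : Fin 2, h.dlin j (a j') = if j' = j then -1 else 0 := fun j j' => by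
    rw [h.dlin_apply]; exact h.der_gen le_rfl j j'
  have d00 : h.dlin 0 (a 0) = -1 := by have := hgen 0 0; rwa [if_pos rfl] at this
  have d01 : h.dlin 0 (a 1) = 0 := by have := hgen 0 1; rwa [if_neg (by decide)] at this
  have d10 : h.dlin 1 (a 0) = 0 := by have := hgen 1 0; rwa [if_neg (by decide)] at this
  have d11 : h.dlin 1 (a 1) = -1 := by have := hgen 1 1; rwa [if_pos rfl] at this
  have done : ∀ j, h.dlin j 1 = 0 := fun j => (h.der le_rfl j).map_one_eq_zero
  have dmul : ∀ j (z w : K), h.dlin j (z * w) = z * h.dlin j w + w * h.dlin j z := fun j z w => by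
    rw [h.dlin_apply, h.dlin_apply, h.dlin_apply, Derivation.leibniz, smul_eq_mul, smul_eq_mul]
  have dneg : ∀ j (z : K), h.dlin j (-z) = -h.dlin j z := fun j z => map_neg _ _
  have dzero : ∀ j, h.dlin j 0 = 0 := fun j => map_zero _
  have two_ne : (2 : K) ≠ 0 := by
    intro h2
    rw [show (2 : K) = ((2 : ℕ) : K) by norm_cast, CharP.cast_eq_zero_iff K p] at h2
    exact hp2 ((Nat.prime_dvd_prime_iff_eq hp.out Nat.prime_two).mp h2)
  have e0 : ν 0 = 0 := by
    have h0 := hz 1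
    simp only [done, dzero, mul_one, mul_zero, add_zero] at h0
    linear_combination h0
  have e1 : ν 1 = 0 := by
    have h1 := hz (a 0)
    simp only [e0, d00, d10, dneg, done, dzero, neg_zero, mul_zero, zero_mul, add_zero, zero_add] at h1
    linear_combination -h1
  have e2 : ν 2 = 0 := by
    have h2 := hz (a 1)
    simp only [e0, e1, d01, d11, dneg, done, dzero, neg_zero, mul_zero, zero_mul, add_zero, zero_add] at h2
    linear_combination -h2
  have e3 : ν 3 = 0 := by
    have h3 := hz (a 0 * a 0)
    simp only [e0, e1, e2, dmul, d00, d10, dneg, dzero, map_add, neg_neg, mul_zero, zero_mul,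
      add_zero, zero_add, mul_one, mul_neg] at h3
    have h3' : ν 3 * 2 = 0 := by linear_combination h3
    exact (mul_eq_zero.mp h3').resolve_right two_ne
  have e4 : ν 4 = 0 := by
    have h4 := hz (a 0 * a 1)
    simp only [e0, e1, e2, e3, dmul, d00, d01, d10, d11, dneg, neg_zero, neg_neg, mul_zero,
      zero_mul, add_zero, zero_add, mul_one, mul_neg] at h4
    linear_combination h4
  have e5 : ν 5 = 0 := by
    have h5 := hz (a 1 * a 1)
    simp only [e0, e1, e2, e3, e4, dmul, d01, d11, dneg, dzero, map_add, neg_zero, neg_neg, mul_zero,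
      zero_mul, add_zero, zero_add, mul_one, mul_neg] at h5
    have h5' : ν 5 * 2 = 0 := by linear_combination h5
    exact (mul_eq_zero.mp h5').resolve_right two_ne
  funext t
  fin_cases t <;> assumption

/-- **The second-order annihilator** (generic two-generator tower, `p ≠ 2`): if `L`-independent elements `v_i ∈ K`, among them `1`,
`a_0`, `a_1`, satisfy one nontrivial relation `Σ_t ν_t · op_t(v_i) = 0` for the six operators, then `D = Σ ν_t op_t ≠ 0` has order `≤ 2`,
kills `1, a_0, a_1` and all `v_i`, MIZUTANI'S LEMMA 2.9 (1) (`finrank_ker_le_two_mul`, encloser-1) bounds `dim_L ker D ≤ 2p`, the `v_i` give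
`#ι ≤ dim_L ker D`, and if `#ι = 2p` then `ker D = span_L{v_i}` («`c(f) = ker D`»).
[cite: Mizutani1973HironakaGroupSchemes, proof of Thm. 2.8, Steps (I)–(II) and Lemma 2.9 (1) (p. 91–92)] -/
theorem IsRootTower.exists_secondOrder_of_sixOps (h : IsRootTower L K (p ^ 1) x a) (hp2 : p ≠ 2) {ι : Type*} [Fintype ι]
    {v : ι → K} (hvind : LinearIndependent L v) (h1 : ∃ i, v i = 1) (ha : ∀ j, ∃ i, v i = a j) {ν : Fin 6 → K}
    (hν0 : ν ≠ 0) (hν : ∀ i, ∑ t, ν t * h.sixOps t (v i) = 0) :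
    ∃ D : K →ₗ[L] K, D = ∑ t, ν t • h.sixOps t ∧ IsDiffOpLE L 2 D ∧ D ≠ 0 ∧ D 1 = 0 ∧ (∀ j, D (a j) = 0) ∧ (∀ i, D (v i) = 0) ∧
      Module.finrank L (LinearMap.ker D) ≤ 2 * p ∧ Fintype.card ι ≤ Module.finrank L (LinearMap.ker D) ∧
      (Fintype.card ι = 2 * p → LinearMap.ker D = Submodule.span L (Set.range v)) := by
  classical
  obtain ⟨D, hDdef⟩ : ∃ D : K →ₗ[L] K, D = ∑ t, ν t • h.sixOps t := ⟨_, rfl⟩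
  have hDapply : ∀ z, D z = ∑ t, ν t * h.sixOps t z := fun z => by
    rw [hDdef, LinearMap.sum_apply]
    exact Finset.sum_congr rfl fun t _ => by rw [LinearMap.smul_apply, smul_eq_mul]
  have hDv : ∀ i, D (v i) = 0 := fun i => by rw [hDapply]; exact hν i
  have hDord : IsDiffOpLE L 2 D := by
    rw [hDdef]
    exact IsDiffOpLE.sum _ fun t _ => IsDiffOpLE.smul _ (h.isDiffOpLE_sixOps t)
  have hD1 : D 1 = 0 := by obtain ⟨i, hi⟩ := h1; rw [← hi]; exact hDv i
  have hDa : ∀ j, D (a j) = 0 := fun j => by obtain ⟨i, hi⟩ := ha j; rw [← hi]; exact hDv i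
  have hD0 : D ≠ 0 := by
    intro hD
    rw [hDdef] at hD
    exact hν0 (h.eq_zero_of_sum_smul_sixOps_eq_zero hp2 hD)
  have hker := h.finrank_ker_le_two_mul D hDord hD0 hD1 hDa
  haveI := h.finiteDimensional
  have hle : Submodule.span L (Set.range v) ≤ LinearMap.ker D := by
    rw [Submodule.span_le]
    rintro _ ⟨i, rfl⟩
    exact LinearMap.mem_ker.mpr (hDv i)
  have hspan : Module.finrank L (Submodule.span L (Set.range v)) = Fintype.card ι := finrank_span_eq_card hvind
  have hcard : Fintype.card ι ≤ Module.finrank L (LinearMap.ker D) := by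
    rw [← hspan]; exact Submodule.finrank_mono hle
  refine ⟨D, hDdef, hDord, hD0, hD1, hDa, hDv, hker, hcard, fun heq => ?_⟩
  exact (Submodule.eq_of_le_of_finrank_le hle (by rw [hspan, heq]; exact hker)).symm

/-- **`#ι ≤ 2p` from a second-order relation** (the count alone). [cite: Mizutani1973HironakaGroupSchemes, proof of Thm. 2.8, Step (II) (p. 92)] -/
theorem IsRootTower.card_le_two_mul_of_sixOps (h : IsRootTower L K (p ^ 1) x a) (hp2 : p ≠ 2) {ι : Type*} [Fintype ι]
    {v : ι → K} (hvind : LinearIndependent L v) (h1 : ∃ i, v i = 1) (ha : ∀ j, ∃ i, v i = a j) {ν : Fin 6 → K}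
    (hν0 : ν ≠ 0) (hν : ∀ i, ∑ t, ν t * h.sixOps t (v i) = 0) : Fintype.card ι ≤ 2 * p := by
  obtain ⟨D, -, -, -, -, -, -, hker, hcard, -⟩ := h.exists_secondOrder_of_sixOps hp2 hvind h1 ha hν0 hν
  omega

end SixOps

end Summit.ResolutionOfSingularities.KangarooAtlas.Mizutani

end
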